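import Literature.NumberTheory.EllipticCurves.KatoAdditiveTwistedValueNeronIntegrality
import HarnessLib

/-!
# Kato's integral zeta elements read in NÉRON units at the ADDITIVE prime `p = 2`, for characters of ODD
# order with `χ(8) ≠ 1` (the Kosters–Pannekoek `2`-torsion of `E₀` over unramified extensions is a
# unipotent-or-order-`3` Frobenius module of the dual-exponential receptacle and is invisible to such `χ`),
# against the least real Néron period — named fact

Topic `NumberTheory/EllipticCurves`. ONE named fact (`def … : Prop`, D-0014), the `p = 2` sibling of
`kato_neron_isIntegral_twistedSymbolSum_of_additive` (`7 < p`), `…_five_le` (`5 ≤ p`) and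
`kato_neron_isIntegral_twistedSymbolSum_of_additive_three_polar` (`p = 3`,
`KatoAdditiveTwistedValueNeronIntegralityThree.lean`): same shape (symmetrised Euler factor, `IsIntegral` form),
PLUS side only (an odd-order character is even), with TWO differences forced by `p = 2`: the receptacle step is the
`p = 2` row of Kosters–Pannekoek's table (the computation (Q1)–(Q5) below, which is NOT in print as such — a
DERIVED READING, flagged for the referee), and the period bookkeeping keeps the archimedean factor
`#π₀(V(ℝ)) ∈ {1, 2}` (a unit at odd `p`, not at `2`). Requested by cell `pub/bsd-f2-manin` (Euler-system lens,
MEMO-es §19, typing ask T-es-10; row F-es-21 of its CANDIDATES.md; statement VERBATIM the cell file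
HOME/es/T-es-10-draft.lean a2b03c487931af06 FILE 1). Consumer: line `kato-shift-two` of the deciding crux C2
`ManinOddAtFour` (stmt-BirchSwinnertonDyer-22967 of route
`Summits/BirchSwinnertonDyer/BirchSwinnertonDyer/Theses/ManinLocalTwoThree.lean`), stub `stub_katoFactTwoPolar`.

## The printed statements (first-hand; locators to the held copies)

* K. Kato, Astérisque 295 (2004) [Kato2004Asterisque] (held `paper:doi-10-24033-ast-639`): Chapter II "we fix a
  prime number `p`" (PDF p. 64); **(8.1.2)–(8.1.3)** (p. 180: `m ≥ 1`, `p ∈ S`, `prime(cd) ∩ S = ∅`, `(cd, 6) = 1`,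
  `(d, N) = 1`; `_{c,d}z_m^{(p)}(f, r, r′, ξ, S) ∈ H¹(ℤ[1/p, ζ_m], V_{O_λ}(f)(k − r))`); **Thm. 9.7** (p. 189: "Let
  the notation be as in (8.1.3). Assume `1 ≤ r ≤ k − 1`, and at least one of `r, r′` is `k − 1`" — no restriction
  on `p`; `exp*` sends the element to `_{c,d}δ_m(f, r, r′, ξ, S)`); **Thm. 6.6 (1)** (p. 163); **Thm. 12.6 (2)**
  (p. 222: the `SL₂(ℤ)`-type elements, `(cd, 6pN) = 1`, `c ≡ d ≡ 1 mod N`); remark after **(12.8.1)** (p. 223: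
  stable lattices are homothetic when `T/𝔪T` is irreducible). NOT used: Thm. 12.5 (4), which reads "Assume
  `p ≠ 2`, and assume (12.5.2)" (p. 222, PDF p. 107 L15).
* M. Kosters, R. Pannekoek, arXiv:1703.07888 [KostersPannekoek2017] (held `paper:arxiv-1703.07888`). **Thm. 1 (i)**
  (p. 3): `K/ℚ₂` unramified of degree `n`, `a_i ∈ 2O_K`: `E₀(K) ≅ ℤ₂ⁿ` unless "(i) `p = 2` and the equation
  `\overline{a₃/2}x³ + \overline{a₁/2}x − 1 = 0` has a solution in `k`", and then
  `E₀(K) ≅ ℤ₂ⁿ × (ℤ/2ℤ)^b` "where `2^b` is the number of solutions to `\overline{a₃/2}X⁴ + \overline{a₁/2}X² − X = 0`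
  in `k`"; **Cor. 2 (i)** (p. 3): over `ℚ₂`, exceptional iff `a₁ + a₃ ≡ 2 (mod 4)`; **Prop. 10** (p. 6): "For
  `i > e/(p−1)` or if `p = 2` and `i ≥ e/(p−1)`, one has `E_i(K) ≅ ℤ_pⁿ` and `pE_i(K) = E_{i+e}(K)`" (so at `p = 2`,
  `e = 1`: `E₁(K) ≅ ℤ₂ⁿ`, `2E₁ = E₂`); **§3.3.1 table, `p = 2`** (p. 7):
  `[2](T) = 2T − a₁T² − 2a₂T³ + (a₁a₂ − 7a₃)T⁴ + …`, `g = T − \overline{a₁/2}T² − \overline{a₃/2}T⁴` — the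
  multiplication-by-`2` map `E₀/E₁ = k → E₁/E₂ = k`; **Lemma 7**, **Lemma 9** (pp. 5–6); **Example 13** (p. 7:
  `E₂ : Y² + 2Y = X³ − 2`, additive at `2`, the `2`-torsion point `(1, −1)` is of good reduction; over `ℚ₂(ζ₃)`
  four such points).
* C.-H. Kim, K. Nakamura, J. Number Theory 210 (2020) [KimNakamura2020] p. 5 (the perfect pairing
  `Tr ∘ ⟨−,−⟩_dR` "induced from the local Tate duality", Cor. 2.4 — its MECHANISM only; their Prop. 2.2 assumes
  `p` odd and is NOT used); D. Delbourgo, J. Number Theory 95 (2002) [Delbourgo2002] p. 50 L60–63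
  (`Tr_{K/ℚ_p}[exp*(x), W] = inv(x ∪ exp W)`); S. Bloch, K. Kato (1990) [BlochKato1990] §3; B. Mazur, J. Tate,
  J. Teitelbaum (1986) §I.8 (8.6) (Birch's formula; tree `twistedSymbolSum`).

## The derivation (the typed statement is its last line)

`V/ℚ` globally minimal, ADDITIVE at `2`, `E[2]` irreducible (⟺ no rational `2`-torsion ⟺ no rational
`2`-isogeny: every curve of the class has irreducible `E[2]` and is ODD-isogenous to `V`), newform `f` of level
`N`, `(m, 2N) = 1`, `K = ℚ(ζ_m)`, `χ` primitive mod `m`, `χ ≠ 1`, of ODD order `n`; `v ∣ 2`: `K_v ≅ ℚ_{2^f}`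
unramified, `f = ord_m(2)`, residue field `k`, Frobenius `F`; `σ₂ ∈ Gal(K/ℚ)` (`ζ_m ↦ ζ_m²`) induces `F` on
each `K_v`; `ζ := χ(2)` (an odd-order root of unity, `ζ^f = χ(2^f) = 1`).
1. (Lattice — sibling item 1, any `p`.) Every stable `ℤ₂`-lattice of `V₂E` is `2^aT₂E` (remark after
   (12.8.1): Nakayama, valid at `p = 2`); the rational identification `V_{ℚ₂}(f)(1) ≅ V₂E` (Kato 8.3 / the
   `X₁(N)`-optimal parametrisation) then gives Kato's (8.1.3)-classes `z_γ ∈ H¹(O_K[1/2], T₂E)`, `ℤ₂`-linearly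
   in `γ ∈ H₁(E(ℂ), ℤ)` (`r = r′ = 1`, `ξ ∈ SL₂(ℤ)`, `S = prime(2mN)`, `prime(cd) ∩ S = ∅`, `(cd, 6) = 1`,
   `c ≡ d ≡ 1 mod N`).
2. (Receptacle at `p = 2`.) Over `K_v` put the minimal additive model in K–P form (`a_i ∈ 2O`, Lemma 9); the
   curve is over `ℚ₂`, so `ᾱ₁ := \overline{a₁/2}`, `ᾱ₃ := \overline{a₃/2}` lie in `𝔽₂`. Let `M₀ := log_ω E₀(K_v)`,
   `R := M₀^∨` (trace dual).
   (Q1) `log E₂ = 4O` ([SI] IV.6.4: `i = 2 > e/(p−1) = 1`); `E₁ ≅ ℤ₂ⁿ`, `2E₁ = E₂` (Prop. 10, `p = 2`, `i = 1`);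
        `log T = T + (a₁/2)T² + ((a₁²+a₂)/3)T³ + (d₄/4)T⁴ + … ≡ T (mod 4O)` for `T ∈ 2O` (`a₁` even), so
        `log E₁ = 2O` and the graded pieces `E₁/E₂ = 2O/4O = k` are identified alike by `T` and by `log`;
        `2E₀ ⊆ E₁`, and `log P := log(2P)/2` (killing the finite `2`-torsion of `E₀`) gives
        `M₀ = {u ∈ O : ū ∈ im g}`, `2O ⊆ M₀ ⊆ O`, with `g = 1 + ᾱ₁F + ᾱ₃F² : k → k` — `𝔽₂`-LINEAR (`x ↦ x²` is
        additive in characteristic `2`; K–P's polynomial `T − ᾱ₁T² − ᾱ₃T⁴` read in `k`).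
   (Q2) `O^∨ = O` (unramified), so `O ⊆ R ⊆ ½O` and `R/O ≅` the trace-orthogonal of `im g` in `k`
        `= ker g*`, `g* = 1 + ᾱ₁F⁻¹ + ᾱ₃F⁻²` (the adjoint of `F` for `Tr_{k/𝔽₂}(xy)` is `F⁻¹`), as an
        `F`-module (`σ₂` acts on `½O/O ≅ k` through `F`). `P := ker g*`:
        `(ᾱ₁, ᾱ₃) = (0,0)`: `P = 0` (`R = O`: the Kim–Nakamura case). `(1,0)`: `P = {Fy = y} = 𝔽₂`, `F = 1` on
        `P`. `(0,1)`: `P = {F²y = y} = 𝔽₄ ∩ k` — `= 𝔽₂` with `F = 1` if `f` is odd, `= 𝔽₄` with `F` the involution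
        (`(F − 1)² = 0`, unipotent) if `f` is even. `(1,1)`: `P = {F²y + Fy + y = 0} ⊆ 𝔽₈ ∩ k`, non-zero only
        if `3 ∣ f`, and then the `𝔽₂`-plane of roots of `y³ + y + 1` on which `F` has order `3`
        (`F² + F + 1 = 0`). [Consistency: `P ∩ {Fy = y} ≠ 0` iff exactly one of `ᾱ₁, ᾱ₃` is `1` iff
        `a₁ + a₃ ≡ 2 (mod 4)` = K–P Cor. 2 (i); and `#P = ` the number of roots of `ᾱ₃X⁴ + ᾱ₁X² + X` in `k`,
        = K–P Thm. 1 (i)'s `2^b` since `P ≅ ker g` as sets of the same size.]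
   (Q3) For `z ∈ H¹(K_v, T₂E)`, `P′ ∈ E(K_v)`: `⟨z, κ(P′)⟩ = ± Tr_{K_v/ℚ₂}(exp*_ω(z)·log_ω(P′)) ∈ ℤ₂` (integral cup
        product via the Weil pairing; Delbourgo p. 50; Bloch–Kato §3; Kim–Nakamura p. 5), hence
        `exp*_ω H¹(K_v, T₂E) ⊆ (log E(K_v))^∨ ⊆ (log E₀(K_v))^∨ = R` — stated with `E(K_v)`, so the component group
        at `2` (order `≤ 4`) plays no role.
   (Q4) Let `Θ := Σ_{i<f} ζ^i F^i`, acting on `P ⊗ 𝔽₂[ζ̄]` (`ζ̄` = `ζ mod 2`; odd-order roots of unity reduce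
        INJECTIVELY mod `2`). On a block with `F = 1`: `Θ = Σ_{i<f} ζ̄^i = 0` when `ζ ≠ 1` (`ζ^f = 1`). On the
        unipotent block (`(0,1)`, `f` even, `F = 1 + ν`, `ν² = 0`): `Θ = Σζ̄^i + ν·Σ iζ̄^i = 0 + ν·f/(ζ̄ − 1) = 0`
        (`ζ ≠ 1`; `1 − ζ` is a `2`-adic unit for `ζ ≠ 1` of odd order; `f` even is `0` in `k`). On the order-`3`
        plane (`(1,1)`, `3 ∣ f`), over `𝔽₄ ∋ ω`: `F` has the eigenvalues `ω, ω²` and `Θ` acts on the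
        `ω^{±1}`-eigenline by `Σ_{i<f}(ζ̄ω^{±1})^i`, which is `0` when `ζ̄ω^{±1} ≠ 1` (as `(ζ̄ω^{±1})^f = 1`), i.e.
        when `ord ζ ≠ 3`. HENCE: if `ζ = χ(2) ≠ 1` and `ord χ(2) ≠ 3` — equivalently `χ(8) = ζ³ ≠ 1` — then `Θ`
        annihilates `P ⊗ 𝔽₂[ζ̄]` for EVERY additive-at-`2` curve (the K–P class only decides which characters
        would have been lost).
   (Q5) GLOBAL CONSEQUENCE. For `X = (X_v)_{v∣2} ∈ ∏_v R_v`, write `X = X⁰ + ½Y`, `X⁰ ∈ ∏ O_v`, `Ȳ_v ∈ P_v`. Then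
        `Σ_{b ∈ (ℤ/m)^×} χ(b)σ_b = (Σ_{c ∈ G/⟨2⟩} χ(c)σ_c) ∘ (Σ_{i<f} ζ^i σ₂^i)` and `σ₂^i` acts on `½O_v/O_v ≅ k`
        as `F^i`; by (Q4), `Σ_i ζ^iσ₂^i(Y) ∈ 2·(∏_v O_v)[ζ]` when `χ(8) ≠ 1`, so `Σ_b χ(b)σ_b(X)` is `2`-INTEGRAL.
3. (Values — sibling item 3 (b), plus side.) Thm. 9.7 + Thm. 6.6 (1) with `γ⁺` a generator of `H₁(E(ℂ), ℤ)⁺`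
   and `ω = ω_E`: `Σ_b χ(b)σ_b(exp*_ω(loc z_{γ⁺})) = T · L_S(E, χ, 1)/Ω₁`, where `Ω₁ = ∫_{γ⁺} ω_E` is the least
   positive real period and `Ω(V) = #π₀(V(ℝ))·Ω₁` (`#π₀ = 2` iff `Δ > 0`); `S = prime(2mN)`,
   `L_S = L·∏_{ℓ∥N}(1 − a_ℓχ(ℓ)ℓ⁻¹)` (Euler factors at the additive prime `2` and at `ℓ ∣ m` are `1`); symmetrising
   the Euler factor as in the sibling's (b) costs an algebraic-integer factor.
4. (Units.) `c ≡ d ≡ 1 (mod N)`, `4 ∣ N` ⟹ `T ≡ (1 − χ̄(c))(1 − χ̄(d))` modulo every prime above `2` (Kato's `T = (c² − c^u χ̄(c))(d² − d^v χ̄(d))`, Thm. 6.6 (1) p. 163, BOTH characters barred; DD-213); choose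
   `c, d` (CRT; `(m, 2N) = 1`; `cd` odd and prime to `3`) with `χ(c), χ(d)` generators of `μ_n`, `n` odd `> 1`:
   `1 − ζ_n` is a `2`-adic unit, so `T` is; `τ(χ)τ(χ̄) = ±m` and the `ℓ ∥ N` are odd. With Birch's formula the
   `χ`-sum of item 3 is `Λ(χ, X)` for `X = exp*_ω(loc₂ z_{γ⁺}) ∈ ∏_v R_v` (items 1, 2 (Q3)), `2`-integral by (Q5).
HENCE, the typed reading: for `V/ℚ` globally minimal with newform `f` at level `N`, ADDITIVE at `2`, `E[2]`
irreducible, `(m, 2N) = 1`, `χ` primitive mod `m`, `χ ≠ 1`, of odd order, with `χ(8) ≠ 1`, and `ϖ ∈ ℚ`,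
`r ∈ ℂ` with `ϖ·Ω(V) = Ω⁺_f` and `∏_{ℓ∥N}(ℓ − a_ℓχ(ℓ))(ℓ − a_ℓχ(ℓ)⁻¹)·Σ_aχ(a){∞,a/m}_f = r·Ω⁺_f`: `s·#π₀(V(ℝ))·ϖ·r`
is an algebraic integer for some ODD `s ∈ ℕ`, where `#π₀(V(ℝ)) = 2` if `Δ(V) > 0` and `1` otherwise (for a
globally minimal `V`, `V.Δ` is the minimal discriminant, whose sign is that of every model). NO Manin-constant,
modular-degree, or curve-side Kosters–Pannekoek binder. Weaker than the derivation in every binder (both the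
`#π₀` factor and the exclusion `χ(8) ≠ 1` are kept even where (Q4) gives more).

WHAT IS PRINT AND WHAT IS READING. Printed verbatim: Kato (8.1.3), 9.7, 6.6 (1), 12.6 (2), the lattice remark;
K–P Thm. 1 (i), Cor. 2 (i), Lemma 7, Prop. 10 (`p = 2` clause), the §3.3.1 `p = 2` row; the duality identity.
Non-verbatim (flag for the referee:
`Kato-(8.1.3)-9.7-6.6-KostersPannekoek-3.3.1-additive-two-twisted-Neron-reading-polar`): the sibling's three steps
(lattice transfer under irreducibility — at `p = 2` WITHOUT Thm. 12.5 (4); period bookkeeping, here with the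
explicit factor `#π₀(V(ℝ))`; unit choice / convention-proofing) AND the receptacle computation (Q1)–(Q5) (an
`𝔽₂`-linear map on `k`, its trace-adjoint kernel in the four cases `(ᾱ₁, ᾱ₃) ∈ 𝔽₂²`, lattice duality in an
unramified field, and the vanishing of `Σ_{i<f} ζ^iF^i` on trivial, unipotent and order-`3` Frobenius blocks),
written out above and re-derived by the vendoring seat (cell typer, seat NOTES «F-es-21 CHECK»); the cell's
hand proof is MEMO-es §19.2, CHECKED independently by the cell's statement refuter (REFUTER-ref1 §R38,
2026-08-27T23:35Z: «I re-derived §19.2 at p = 2» — the four cases, the unipotent correction `n·f/(ζ−1)` vanishing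
because `f` is even, the trace-zero plane with `F` of order `3`, and the semi-local step done elementwise; BC7
probe of this statement CLEAN; A1–A6 read-back clean, every binder load-bearing; verdict F-es-21 SURVIVES-typed);
literature-placement audit REFUTER-ref2 R-es-18 requested. NOT in print as a
statement (nearest printed phenomenon: Delbourgo 2002 §1, the correction `ℓ_p(E)` for the same pole of `exp*`).
Consistency: K–P Example 13 (`E₂ : Y² + 2Y = X³ − 2`: `a₁ = 0`, `a₃ = 2`, `(ᾱ₁, ᾱ₃) = (0, 1)`, `P = 𝔽₄ ∩ k`: one
point of order `2` over `ℚ₂`, three over `ℚ₂(ζ₃)` — as printed); the cell's censuses (E19A: 1061/1061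
irreducible optimal curves with `4 ∣ N ≤ 2000` consistent). No `_holds` (size XL: Kato's explicit reciprocity
law).

## References

* K. Kato, Astérisque 295 (2004): (8.1.2)–(8.1.3) (p. 180), Thm. 6.6 (p. 163), Thm. 9.7 (p. 189), Thm. 12.6 (2)
  and Thm. 12.5 (4) (p. 222), remark after (12.8.1) (p. 223). [Kato2004Asterisque]
* M. Kosters, R. Pannekoek, arXiv:1703.07888 (2017): Thm. 1 (i), Cor. 2 (i), Lemma 7, Lemma 9, Prop. 10, §3.3.1
  (table, `p = 2`), Example 13. [KostersPannekoek2017]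
* C.-H. Kim, K. Nakamura, J. Number Theory 210 (2020): §2.1, Cor. 2.4. [KimNakamura2020]
* D. Delbourgo, J. Number Theory 95 (2002): §1, p. 50. [Delbourgo2002]
* S. Bloch, K. Kato, The Grothendieck Festschrift I (1990): §3. [BlochKato1990]
* C. Wuthrich, Doc. Math. 19 (2014): §3 (the rational identification `V_{ℚ_p}(f)(1) ≅ V_pE•`). [Wuthrich2014]
* B. Mazur, J. Tate, J. Teitelbaum, Invent. Math. 84 (1986): §I.8 (8.6). [MazurTateTeitelbaum1986]
-/

noncomputable section

open scoped MatrixGroups ModularForm Classical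

open CongruenceSubgroup Literature.NumberTheory.EllipticCurves.ModularForms

namespace Literature.NumberTheory.EllipticCurves

/-- **Kato's Euler system read in Néron units at the ADDITIVE prime `2` with `E[2]` irreducible, for every
primitive Dirichlet character `χ` of ODD order, conductor `m` prime to `2N`, with `χ(8) ≠ 1`: the symmetrised
`N`-imprimitive Birch–Manin twisted value is `2`-integral against the LEAST real Néron period
`Ω(V)/#π₀(V(ℝ))`** — the `p = 2` sibling of `kato_neron_isIntegral_twistedSymbolSum_of_additive_three_polar`
(plus side only: an odd-order character is even). A derived reading (weaker than the derivation, never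
stronger) of: K. Kato, Astérisque 295 (2004), **(8.1.3)** (p. 180; Chapter II: "we fix a prime number `p`"),
**Thm. 9.7** (p. 189: "Assume `1 ≤ r ≤ k − 1`, and at least one of `r, r′` is `k − 1`" — no restriction on `p`),
**Thm. 6.6 (1)** (p. 163), **Thm. 12.6 (2)** (p. 222: `(cd, 6pN) = 1`, `c ≡ d ≡ 1 mod N`), the remark after
**(12.8.1)** (p. 223) — and NOT Thm. 12.5 (4) ("Assume `p ≠ 2`"); M. Kosters, R. Pannekoek, arXiv:1703.07888,
**Thm. 1 (i)** ("(i) `p = 2` and the equation `\overline{a₃/2}x³ + \overline{a₁/2}x − 1 = 0` has a solution in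
`k`"; then `E₀(K) ≅ ℤ₂ⁿ × (ℤ/2ℤ)^b`), **Cor. 2 (i)** (`a₁ + a₃ ≡ 2 mod 4`), **Prop. 10** ("or if `p = 2` and
`i ≥ e/(p−1)`": `E₁(K) ≅ ℤ₂ⁿ`, `2E₁ = E₂` for `K/ℚ₂` unramified), the **§3.3.1 table, `p = 2`** (p. 7:
`g = T − \overline{a₁/2}T² − \overline{a₃/2}T⁴` = multiplication by `2` from `E₀/E₁ = k` to `E₁/E₂ = k`); the
duality identity `Tr_{K/ℚ_p}[exp*(x), W] = inv(x ∪ exp W)` (Delbourgo, JNT 95 (2002) p. 50; Bloch–Kato 1990 §3;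
Kim–Nakamura, JNT 210 (2020) p. 5 / Cor. 2.4 — mechanism only); Birch's formula (Mazur–Tate–Teitelbaum 1986
(I.8.6)). DERIVATION = the sibling's items 1 (lattice transfer under irreducibility, Nakayama — valid at `2`), 3
(values, symmetrised Euler factor, PLUS side, with the archimedean bookkeeping `Ω(V) = #π₀(V(ℝ))·Ω₁`, `Ω₁ =` the
period of `ω_E` over a generator of `H₁(E(ℂ),ℤ)⁺`) and 4 (unit choice: `c ≡ d ≡ 1 mod N`, `4 ∣ N` ⟹
`T ≡ (1 − χ̄(c))(1 − χ̄(d))`, a `2`-unit for `χ(c), χ(d)` generators of `μ_n`, `n` odd), with the RECEPTACLE at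
`2` computed as follows over `K_v = ℚ(ζ_m)_v ≅ ℚ_{2^f}`, `ᾱ₁ = \overline{a₁/2}`, `ᾱ₃ = \overline{a₃/2} ∈ 𝔽₂`:
(Q1) `M₀ := log_ω E₀(K_v) = {u ∈ O : ū ∈ im g}`, `g = 1 + ᾱ₁F + ᾱ₃F²` `𝔽₂`-linear on `k` (`log E₁ = 2O`,
`2E₁ = E₂`, `log T ≡ T mod 4` on `2O`); (Q2) `R := M₀^∨ = O + ½·(lifts of P)`, `P = ker(1 + ᾱ₁F⁻¹ + ᾱ₃F⁻²)`:
`P = 0` for `(0,0)`; `F = 1` on `P = 𝔽₂` for `(1,0)` and for `(0,1)` with `f` odd; `F` unipotent on `P = 𝔽₄`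
for `(0,1)` with `f` even; `F` of order `3` on the plane `P ⊆ 𝔽₈` for `(1,1)` (only if `3 ∣ f`); (Q3)
`exp*_ω H¹(K_v, T₂E) ⊆ (log E(K_v))^∨ ⊆ R` (integral cup product; stated with `E(K_v)`); (Q4)
`Θ = Σ_{i<f} ζ^iF^i`, `ζ = χ(2)`, kills `P ⊗ 𝔽₂[ζ̄]` whenever `ζ ≠ 1` and `ord ζ ≠ 3`, i.e. whenever
`χ(8) ≠ 1` (`Σζ̄^i = 0`; `ν·f/(ζ̄−1) = 0` for `f` even; `Σ(ζ̄ω^{±1})^i = 0`; odd-order roots of unity reduce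
injectively mod `2`); (Q5) hence `Σ_bχ(b)σ_b(X)` is `2`-integral for every `X ∈ ∏_{v∣2} R_v`. HENCE: for `V/ℚ`
globally minimal with newform `f` at level `N`, additive at `2`, `E[2]` irreducible, `(m, 2N) = 1`, `χ`
primitive mod `m`, `χ ≠ 1`, `2 ∤ ord χ`, `χ(8) ≠ 1`, `ϖ ∈ ℚ`, `r ∈ ℂ` with `ϖ·Ω(V) = Ω⁺_f` and
`∏_{ℓ∥N}(ℓ − a_ℓχ(ℓ))(ℓ − a_ℓχ(ℓ)⁻¹)·Σ_aχ(a){∞,a/m}_f = r·Ω⁺_f`: `s·#π₀(V(ℝ))·ϖ·r` is an algebraic integer for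
some `s ∈ ℕ` with `2 ∤ s`, `#π₀(V(ℝ)) = 2` if `0 < Δ(V)` else `1`. Flag for the referee:
`Kato-(8.1.3)-9.7-6.6-KostersPannekoek-3.3.1-additive-two-twisted-Neron-reading-polar` (non-verbatim steps: the
sibling's three, here without Thm. 12.5 (4) and with the explicit `#π₀` factor, and (Q1)–(Q5), written out in
the module docstring; re-derived by the vendoring seat and by the cell's statement refuter, REFUTER-ref1 §R38;
the cell's hand proof is MEMO-es §19.2; placement audit REFUTER-ref2 R-es-18 requested; not in print as a
statement — nearest printed phenomenon: Delbourgo 2002 §1). No `_holds` (size XL).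
[cite: Kato2004Asterisque, (8.1.3) (p. 180), Thm. 9.7 (p. 189), Thm. 6.6 (1) (p. 163), Thm. 12.6 (2) (p. 222), remark after (12.8.1) (p. 223)]
[cite: KostersPannekoek2017, Thm. 1 (i), Cor. 2 (i), Lemma 7, Prop. 10, §3.3.1 (table p = 2), Example 13]
[cite: KimNakamura2020, §2.1 (perfect pairing) and Cor. 2.4] [cite: Delbourgo2002, p. 50 (duality identity), §1]
[cite: BlochKato1990, §3 (Prop. 3.8, Def. 3.10, (3.11))] [cite: Wuthrich2014, §3]
[cite: MazurTateTeitelbaum1986, §I.8 (8.6)] -/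
def kato_neron_isIntegral_twistedSymbolSum_of_additive_two_polar : Prop :=
  ∀ (V : WeierstrassCurve ℚ) [V.IsElliptic] [V.IsGloballyMinimal] {N : ℕ} [NeZero N]
    (f : CuspForm (Gamma0 N) 2) (_ : IsNewformOf V f)
    (_ : ¬ V.HasGoodReductionAtPrime 2) (_ : ¬ V.HasMultiplicativeReductionAtPrime 2)
    (_ : V.HasIrreducibleModPGaloisRep 2) (m : ℕ) [NeZero m] (_ : m.Coprime (2 * N))
    (χ : DirichletCharacter ℂ m) (_ : χ.IsPrimitive) (_ : χ ≠ 1) (_ : ¬ 2 ∣ orderOf χ)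
    (_ : χ (8 : ZMod m) ≠ 1) (ϖ : ℚ) (r : ℂ),
    (ϖ : ℝ) * V.realPeriodRat = plusPeriod f →
      (∏ ℓ ∈ N.primeFactors with ¬ ℓ ^ 2 ∣ N,
          (((ℓ : ℂ) - (V.LFunction ℓ : ℂ) * χ (ℓ : ZMod m)) *
            ((ℓ : ℂ) - (V.LFunction ℓ : ℂ) * (χ (ℓ : ZMod m))⁻¹))) *
          twistedSymbolSum f χ = r * (plusPeriod f : ℂ) →
      ∃ s : ℕ, ¬ 2 ∣ s ∧ IsIntegral ℤ ((s : ℂ) * ((if 0 < V.Δ then 2 else 1 : ℕ) : ℂ) * ϖ * r)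

end Literature.NumberTheory.EllipticCurves

end
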